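import Summits.QuantumFields.YangMills.Theorems.BalabanUVNodesN18GeometricIncrementsOfLocalTerms
import Summits.QuantumFields.YangMills.Theorems.BalabanUVNodesN18RunDifferenceOfLocalTermsHolomorphic
import Summits.QuantumFields.YangMills.Theorems.BalabanUVNodesN18PolLimitRateOfGeometricIncrements

/-!
# BalabanUVNodes ∕ N18 (node U3's kernel objects) — NODE U3's LETTERS OF RECORD FROM ONE TERM-DATA PACKAGE: the four U3 rows this lineage's termwise roads produce —
# W1-21 `GeometricIncrementsOfRecord₁₃` (`r < 1`), (1.21) `PolLimitsExistOfRecord₁₃`, `WindowedStepRateOfRecord₁₃ … 1 …`, node N18's `KernelStepRateOfRecord₁₃` — as ONE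
# conjunction from ONE de-duplicated data list (W1-20's law + single-run ANALYTICITY with (4.35) tails and (1.18) decay + the local stability RATE + the two-run
# holomorphic data), (1.21)-existence DISCHARGED inside
# (Track A, DAG node N18 = NE5 ∕ node U3's letters; key K3⁸ `SpineGivenEndpointR13SepCoPHV` = stmt-QuantumFields-27366; cell `pub-ymgap`, WIDTH SEAT `pub-ymgap-dag-n18-w2` g10,
# FILE 1; `--kind proof --supports stmt-QuantumFields-27366 --as helper`, COUNT-NEUTRAL; THEOREMS ONLY, 0 `def`, 0 `sorry`)

WHY.  The K3 bills of the n27 lane display node U3's rows by letter name: the limit-letters bill `hL : PolLimitsExistOfRecord₁₃`, `h18L : KernelStepRateOfRecord₁₃ … κ θ₅ C₅`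
(+ the n22 lane's `h9`, the level-0 base `h0L`), the finite-volume bill `hr : r < 1`, `hinc : GeometricIncrementsOfRecord₁₃ … r`, `hS : WindowedStepRateOfRecord₁₃ … s κ θ₅ (C₅θ₅)`
(+ `h9`, `hW`) (dag-n27-w1 `…N27AtMintedReading13CoPHVCutBFreeLetters`).  This seat's g9 gave every one of `hL ∕ h18L ∕ hinc ∕ hS` a termwise producer — three roads with
three hypothesis lists that overlap ((A) `…N18RunDifferenceOfLocalTermsHolomorphic`: analyticity of the matched terms + ONE term-level two-run sup bound, (1.21)-existence
DISPLAYED as `hex`; (B) `…N18PolLimitsExistOfLocalTerms{,Local}`: `C²` charts + soft value majorants + local truncation stability; (C) `…N18GeometricIncrementsOfLocalTerms`: the same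
`C²` charts + majorants + the local stability RATE), and g6 (`…N18PolLimitRateOfGeometricIncrements`) the two junctions `hinc ⇒ hL` and `hinc + hS ⇒ h18L`.  THIS FILE closes the
square: ONE theorem, ONE data list, the FOUR letters (and `r < 1`) at once — (1.21)-existence is no longer an input anywhere (`hinc ⇒ hL`, so (A)'s `hex` and (B)'s
truncation-stability law both disappear behind (C)'s rate law), node N18's letter comes from `hinc + hS` at `s := 1`, and the two displayed rows `hC` (C² charts) ∕ `hval`
(soft VALUE majorants) of (B)∕(C) are PRODUCED from one print-shaped analytic input — per term a holomorphic representation of its β-chart through a complexification of the probe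
fields carrying the (4.35) tails, with the (1.18) sup bound `E₀e^{−κd(X)}` on a ball ([I] p. 264 «an analytic function … uniformly bounded … together with all derivatives»,
(1.18) p. 263, (4.35)–(4.37) pp. 290–291) — by dag-n22-c's J28 Cauchy estimate (`abs_polTensor_le_of_holomorphic`, `contDiffAt_two_of_holomorphic`).

WHAT (`M = L^{m′}`; `δ₁ := ½min{δ₀, κ(4M)⁻¹}` = `delta1 δ₀ κ (4M)`, `C₅′ := (16M₀B₃²∕r²) e^{12Mδ₁}K₀(64,8)K₁(4,δ₀∕2)`, `r_inc := max{ω^{1∕2}, e^{−ηc}}`, `η = min{κ,δ₀}∕2`,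
`c = −log ω∕(2(a+1))`):
* §1 (one term; generic `(𝔄, V, ι)`): `abs_polComp_expChart_le_of_holomorphicValue` (analytic repr + sup bound `M` + one-site weights ⇒ `|Π^{cc}(x,y)| ≤ 16Mr⁻²·w(x)w(y)`) ·
  `contDiffAt_expChart_zero_of_holomorphic` · ★★ `chartData_localizedSum_of_holomorphicValue` (for W1-20's localized sum on a window `W`: the analytic package ⇒ `hC ∧ hval` in
  (B)∕(C)'s EXACT spelling, `C_E = 16E₀B₃²∕r²`).
* §2 ★★★ `u3LettersOfRecord₁₃_of_localTermData` (RECORD, under W1-20's law; chart-data edition: `hC hval hstab` of (C) verbatim + (A)'s two-run holomorphic data verbatim, ONE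
  `(κ, δ₀)` ⇒ `r_inc < 1 ∧ GeometricIncrementsOfRecord₁₃ F N θ r_inc ∧ PolLimitsExistOfRecord₁₃ F N θ ∧ WindowedStepRateOfRecord₁₃ F N θ 1 δ₁ θ₅ (C₅′θ₅) ∧
  KernelStepRateOfRecord₁₃ F N θ δ₁ θ₅ C₅′`).
* §3 ★★★ `u3LettersOfRecord₁₃_of_analyticLocalTermData` (the same with §1's analytic package in place of `hC ∕ hval`).
* §4 ★ `u3KernelInputs_of_analyticLocalTermData` (pin form at a letter reading `ℓ : U3Letters₁₁` with `ℓ.κ = δ₁`, `ℓ.θ₅ = θ₅`, `ℓ.C₅ = C₅′`, `ℓ.Signs`, the n22 lane's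
  `h9 ∕ hW` DISPLAYED ⇒ g6's `KernelDecayOfRecord₁₃ … ∧ (∀ k, N18At …) ∧ ∀ k, N22At …` — the three kernel-side U3 inputs of the (Kꜰ) pin).

HONEST FRAMING — what this is NOT.  Count-neutral COMPOSITION of landed junctions (g9 FILES 4∕7, g6, dag-n22-c J28) plus one Cauchy-estimate corollary; NO estimate of Bałaban's is
proved or asserted — W1-20's law (1.7), the analytic representations with tails and (1.18) decay (NODE A ∕ N10), the local stability rate (quantitative volume independence of
the small near terms, [II] (2.13)–(2.14)) and the TERM-LEVEL TWO-RUN SUP BOUND `‖G_B − G_A‖ ≤ M₀θ₅^{k+1}e^{−κd(X)}` (node N18's content — King's mechanism at term level, NOT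
PRINTED for d = 4) are DISPLAYED hypotheses; nothing of the merged term (1.6) or of the (2.13) terms is constructed; no letter OF RECORD inhabited; N18 ∕ N22 ∕ (D4) NOT
discharged; K3⁸ OPEN (skeleton v6 untouched), not claimed; counts UNMOVED (typed 28∕28 · discharged 5∕27 (A 5∕28)); one finite four-torus programme at fixed ε, Bałaban AS
PRINTED; R4 closes the conditional finite-𝕋⁴ rung `BalabanLadder.UV` only — NOT ℝ⁴, NOT infinite volume, NOT OS, NOT a mass gap; the Clay problem is NOT proved by any of this.

References (TYPES only): [I] = [Balaban1987RG1] Thm 1 p. 259, (1.7) p. 261, (1.18) p. 263, (1.20)–(1.21) p. 264, (4.35)–(4.36) p. 290, (4.37) p. 291, (5.10) p. 293;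
[II] = [Balaban1988RG2Cluster] (2.13)–(2.14) pp. 14–15; C. King, CMP 102 (1986) [King1986] (3.73) p. 665.  Imports g9 FILE 7 and FILE 4 (v1.1) and g6's junction file BY
NAME (through them FILES 1∕2∕5∕6, dag-n22-w2's storeys, dag-n22-c's J27∕J28, def-W1's files); nothing re-declared.
-/

noncomputable section

namespace YMDAG.N18.U3LettersPackage

open Filter Metric Set
open scoped BigOperators Topology
open Literature.MathematicalPhysics.QuantumFieldTheory.Balaban1983to89
open Literature.MathematicalPhysics.QuantumFieldTheory.Balaban1983to89.T4Continuum (T4Family)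
open Literature.MathematicalPhysics.QuantumFieldTheory.Balaban1983to89.FlowStep (Box)
open Literature.MathematicalPhysics.QuantumFieldTheory.Balaban1983to89.B12PolarizationTensor120 (polComp expChart)
open Literature.MathematicalPhysics.QuantumFieldTheory.Balaban1983to89.Node00 (Stage13Params polScalar siteOfInt MatA U3Letters₁₁)
open Literature.MathematicalPhysics.QuantumFieldTheory.Balaban1983to89.Node00.U3OfKernels (histPrefix objectsOfRecord₁₃ KernelDecayOfRecord₁₃)
open Literature.MathematicalPhysics.QuantumFieldTheory.Balaban1983to89.Node00.U3KernelLetters (PolLimitsExistOfRecord₁₃ GeometricIncrementsOfRecord₁₃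
  WindowedStepRateOfRecord₁₃ KernelStepRateOfRecord₁₃ WindowedNE9OfRecord₁₃ WindowedDecayOfRecord₁₃)
open Literature.MathematicalPhysics.QuantumFieldTheory.Balaban1983to89.Node00.LocalizedSum17 (localizedSum ReadingMaps Localizes17OfRecord₁₃)
open Literature.MathematicalPhysics.QuantumFieldTheory.Balaban1983to89.Node00.Sect2 (domSys domCount)
open Literature.MathematicalPhysics.QuantumFieldTheory.Balaban1983to89.Node00.W1 (ClusterTower castDom domSys_succ)
open Literature.MathematicalPhysics.QuantumFieldTheory.Balaban1983to89.T4LevelShift (siteShift)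
open Literature.MathematicalPhysics.QuantumFieldTheory.Balaban1983to89.T4OutputRate (Window)
open Literature.MathematicalPhysics.QuantumFieldTheory.Balaban1983to89.B12Decay510 (delta1)
open Literature.MathematicalPhysics.QuantumFieldTheory.Balaban1983to89.B12Decay510Window (K₁)
open Literature.MathematicalPhysics.QuantumFieldTheory.Balaban1983to89.B12Decay510Torus (distCT nearT)
open Literature.MathematicalPhysics.QuantumFieldTheory.Balaban1983to89.B12TreeDecay (K₀ kappa₀ kappa₀_nonneg)
open Literature.MathematicalPhysics.QuantumFieldTheory.Balaban1983to89.TreeLengthTorus (TPt torusTreeLen)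
open YMDAG.N22.WindowOfLocalTerms (abs_polTensor_le_of_holomorphic contDiffAt_two_of_holomorphic)
open YMDAG.N18.TwoRunWindowLevelShift (ladder)
open YMDAG.N18.GeometricIncrementsOfLocalTerms (geometricIncrementsOfRecord₁₃_of_localStabilityRate twoScaleRate_lt_one)
open YMDAG.N18.RunDifferenceOfLocalTerms (windowedStepRateOfRecord₁₃_one_of_holomorphicTwoRun)
open YMDAG.N18.PolLimitRate (polLimitsExistOfRecord₁₃_of_geometricIncrements kernelStepRateOfRecord₁₃_of_geometricIncrements_of_windowed
  u3KernelInputs_of_finiteVolumeLetters)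
open YMDAG.UVSplit (N18At N22At u3OfRecord₁₃)

/-! ## §1 One print-shaped analytic input ⇒ the `C²` chart and the soft VALUE majorant of a term (dag-n22-c's J28 Cauchy estimate, single-function form) -/

section OneTerm

variable {Ec : Type*} [NormedAddCommGroup Ec] [NormedSpace ℂ Ec]
variable {𝔄 : Type*} [NormedRing 𝔄] [NormedAlgebra ℝ 𝔄] {V : Type*} [NormedAddCommGroup V] [NormedSpace ℝ V] {ι' : Type*}
  {Λ T : Type*} [Fintype Λ] [Fintype T]

/-- Real arithmetic behind the soft value majorant (stated once, closed by `ring`, consumed by `exact` — defeq-robust against the `Fin (F.P K).d`-binders of the cast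
geometry). [folklore] -/
theorem sixteen_mul_weights_eq (E₀ r B₃ X₁ X₂ X₃ : ℝ) :
    16 * (E₀ * X₁) / r ^ 2 * (B₃ * X₂ * (B₃ * X₃)) = 16 * E₀ * B₃ ^ 2 / r ^ 2 * X₁ * X₂ * X₃ := by
  ring

/-- **ANALYTICITY + A SUP BOUND ⇒ THE SOFT VALUE MAJORANT OF ONE TERM.**  If the β-chart `B ↦ ℰ(exp ρB)` of a term is `Re G(ι B)` for a real-linear complexification `ι` of the
probe fields and `G` holomorphic on an open `U ⊇ ball 0 r` with `‖G‖ ≤ M` on that ball, and the one-site colour directions have `‖ι e_{l,t,c}‖ ≤ w(t)`, then every diagonal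
component of (1.20) obeys `|Π^{cc}_{μν}(x, y)| ≤ 16 M r⁻² · w(x) w(y)` (J28 `abs_polTensor_le_of_holomorphic`; [I] p. 264 «an analytic function … uniformly bounded … together
with all derivatives»). [cite: Balaban1987RG1, (1.18) p.263 and (1.20)-(1.21) p.264] -/
theorem abs_polComp_expChart_le_of_holomorphicValue [DecidableEq Λ] [DecidableEq T] (ℰ : (Λ → T → 𝔄) → ℝ) (ρ : V →L[ℝ] 𝔄) (bV : Module.Basis ι' ℝ V)
    (G : Ec → ℂ) {U : Set Ec} (hG : DifferentiableOn ℂ G U) (hU : IsOpen U) {r M : ℝ} (hr : 0 < r) (hrU : ball (0 : Ec) r ⊆ U)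
    (hM : ∀ z ∈ ball (0 : Ec) r, ‖G z‖ ≤ M) (ι : (Λ → T → V) →L[ℝ] Ec) (hf : ∀ B, expChart ℰ ρ B = (G (ι B)).re)
    (w : T → ℝ) (hw : ∀ (l : Λ) (t : T) (c : ι'), ‖ι (Pi.single l (Pi.single t (bV c)))‖ ≤ w t)
    (μ : Λ) (x : T) (ν : Λ) (y : T) (c : ι') :
    |polComp ℝ (expChart ℰ ρ) bV μ x c ν y c| ≤ 16 * M / r ^ 2 * (w x * w y) := by
  simp only [polComp]
  have hM0 : 0 ≤ M := (norm_nonneg _).trans (hM 0 (mem_ball_self hr))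
  have hwx : 0 ≤ w x := (norm_nonneg _).trans (hw μ x c)
  have h16 : 0 ≤ 16 * M / r ^ 2 := by positivity
  calc |B12PolarizationTensor120.polTensor ℝ (expChart ℰ ρ) μ x (bV c) ν y (bV c)|
      ≤ 16 * M / r ^ 2 * ‖ι (Pi.single μ (Pi.single x (bV c)))‖ * ‖ι (Pi.single ν (Pi.single y (bV c)))‖ :=
        abs_polTensor_le_of_holomorphic G hG hU hr hrU hM ι _ hf μ x (bV c) ν y (bV c)
    _ ≤ 16 * M / r ^ 2 * w x * w y :=
        mul_le_mul (mul_le_mul_of_nonneg_left (hw μ x c) h16) (hw ν y c) (norm_nonneg _) (mul_nonneg h16 hwx)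
    _ = 16 * M / r ^ 2 * (w x * w y) := by ring

/-- **ANALYTICITY ⇒ THE `C²` CHART AT `0`.**  With the same representation `expChart ℰ ρ = Re G ∘ ι` (`G` holomorphic on an open `U ⊇ ball 0 r`, `r > 0`), the β-chart is
`C²` at `B = 0` (J28 `contDiffAt_two_of_holomorphic` at `ι 0 = 0 ∈ U`). [cite: Balaban1987RG1, (1.20) p.264] -/
theorem contDiffAt_expChart_zero_of_holomorphic (ℰ : (Λ → T → 𝔄) → ℝ) (ρ : V →L[ℝ] 𝔄)
    (G : Ec → ℂ) {U : Set Ec} (hG : DifferentiableOn ℂ G U) (hU : IsOpen U) {r : ℝ} (hr : 0 < r) (hrU : ball (0 : Ec) r ⊆ U)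
    (ι : (Λ → T → V) →L[ℝ] Ec) (hf : ∀ B, expChart ℰ ρ B = (G (ι B)).re) :
    ContDiffAt ℝ 2 (expChart ℰ ρ) 0 := by
  have h : expChart ℰ ρ = fun B => (G (ι B)).re := funext hf
  rw [h]
  exact contDiffAt_two_of_holomorphic G hG hU ι (by rw [map_zero]; exact hrU (mem_ball_self hr))

end OneTerm

/-! ## §1b The analytic package for W1-20's localized sum ⇒ the rows `hC ∧ hval` of roads (B)∕(C), in their exact spelling -/

section ChartData

variable {Ec : Type*} [NormedAddCommGroup Ec] [NormedSpace ℂ Ec]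
variable {𝔄 : Type*} [NormedRing 𝔄] [NormedAlgebra ℝ 𝔄] {V : Type*} [NormedAddCommGroup V] [NormedSpace ℝ V] {ι : Type*} {𝔸 : Type*}
variable (F : T4Family) (M : ℕ) [NeZero M]
variable (S : (K : ℕ) → ClusterTower (F.P K) 𝔸 M) (emb : ReadingMaps F 𝔄 𝔸) (ρ : V →L[ℝ] 𝔄) (bV : Module.Basis ι ℝ V)

/-- ★★ **THE ANALYTIC PACKAGE ⇒ `hC ∧ hval`.**  For W1-20's localized sum read through `emb`: if for every coupling sequence `g` of the window `W`, every level `k`, volume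
index `K` and domain `X ∈ 𝐃_{k+1}(T_K)` the (2.13) term's β-chart is `Re G ∘ ι` — `ι = ι g k K X` a real-linear complexification of the probe fields of `T^{(k+1)}_K` whose
one-site colour directions carry the (4.35) tails `‖ι e_{l,t,c}‖ ≤ B₃ e^{−δ₀ distCT(cast t, X)}` in the cast geometry of record, `G = G g k K X` holomorphic on an open
`U ⊇ ball 0 r`, with the (1.18) sup bound `‖G‖ ≤ E₀ e^{−κ d(X)}` on that ball (`r > 0`, `E₀, B₃ ≥ 0` free of everything) — THEN (i) every chart is `C²` at `0` and (ii) the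
diagonal kernel components obey the K-uniform soft VALUE majorant with `C_E = 16E₀B₃²∕r²` — the two displayed rows `hC`, `hval` of `…N18PolLimitsExistOfLocalTerms{,Local}` ∕
`…N18GeometricIncrementsOfLocalTerms`, verbatim. [cite: Balaban1987RG1, (1.7) p.261, (1.18) p.263, (1.20)-(1.21) p.264, (4.35)-(4.36) p.290 and (4.37) p.291] -/
theorem chartData_localizedSum_of_holomorphicValue (W : Set (ℕ → ℝ)) {r E₀ B₃ κ δ₀ : ℝ} (hr : 0 < r) (hE₀ : 0 ≤ E₀)
    (ι₁ : (g : ℕ → ℝ) → (k K : ℕ) → (domSys (F.P K) M (k + 1)).Dom → ((Fin (F.P K).d → Site (F.P K) (k + 1) → V) →L[ℝ] Ec))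
    (G₁ : (g : ℕ → ℝ) → (k K : ℕ) → (domSys (F.P K) M (k + 1)).Dom → Ec → ℂ)
    (U₁ : (g : ℕ → ℝ) → (k K : ℕ) → (domSys (F.P K) M (k + 1)).Dom → Set Ec) (hU₁ : ∀ g k K X, IsOpen (U₁ g k K X))
    (hG₁ : ∀ g k K X, DifferentiableOn ℂ (G₁ g k K X) (U₁ g k K X)) (hrU₁ : ∀ g k K X, ball (0 : Ec) r ⊆ U₁ g k K X)
    (hf₁ : ∀ g ∈ W, ∀ (k K : ℕ) (X : (domSys (F.P K) M (k + 1)).Dom) (B : Fin (F.P K).d → Site (F.P K) (k + 1) → V),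
      expChart (fun W' => (((S K) k).E (histPrefix g k) (emb K k W') X).re) ρ B = (G₁ g k K X (ι₁ g k K X B)).re)
    (hsup₁ : ∀ g ∈ W, ∀ (k K : ℕ) (X : (domSys (F.P K) M (k + 1)).Dom), ∀ ζ ∈ ball (0 : Ec) r, ‖G₁ g k K X ζ‖ ≤ E₀ * Real.exp (-κ * torusTreeLen X.1))
    (htail₁ : ∀ (g : ℕ → ℝ) (k K : ℕ) (X : (domSys (F.P K) M (k + 1)).Dom) (l : Fin (F.P K).d) (t : Site (F.P K) (k + 1)) (c : ι),
      let e : Site (F.P K) (k + 1) → TPt 4 (domCount (F.P K) M (k + 1) * M) := fun x i => (ZMod.cast (x i) : ZMod (domCount (F.P K) M (k + 1) * M))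
      ‖ι₁ g k K X (Pi.single l (Pi.single t (bV c)))‖ ≤ B₃ * Real.exp (-δ₀ * distCT (domCount (F.P K) M (k + 1)) M (e t) (nearT (M := M) (e t) X))) :
    (∀ g ∈ W, ∀ (k K : ℕ) (X : (domSys (F.P K) M (k + 1)).Dom), ContDiffAt ℝ 2 (expChart (fun W' => (((S K) k).E (histPrefix g k) (emb K k W') X).re) ρ) 0) ∧
    (∀ g ∈ W, ∀ (k : ℕ) (μ ν : Fin 4) (z : Fin 4 → ℤ), ∃ CE : ℝ, 0 ≤ CE ∧ ∀ (K : ℕ) (X : (domSys (F.P K) M (k + 1)).Dom) (c : ι),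
      let e : Site (F.P K) (k + 1) → TPt 4 (domCount (F.P K) M (k + 1) * M) := fun x i => (ZMod.cast (x i) : ZMod (domCount (F.P K) M (k + 1) * M))
      |polComp ℝ (expChart (fun W' => (((S K) k).E (histPrefix g k) (emb K k W') X).re) ρ) bV (Fin.cast (F.P_d K).symm μ) (siteOfInt F K (k + 1) z) c
          (Fin.cast (F.P_d K).symm ν) (siteOfInt F K (k + 1) 0) c| ≤
        CE * Real.exp (-κ * torusTreeLen X.1) * Real.exp (-δ₀ * distCT (domCount (F.P K) M (k + 1)) M (e (siteOfInt F K (k + 1) z)) (nearT (M := M) (e (siteOfInt F K (k + 1) z)) X)) *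
          Real.exp (-δ₀ * distCT (domCount (F.P K) M (k + 1)) M (e (siteOfInt F K (k + 1) 0)) (nearT (M := M) (e (siteOfInt F K (k + 1) 0)) X))) := by
  refine ⟨fun g hg k K X => contDiffAt_expChart_zero_of_holomorphic _ ρ (G₁ g k K X) (hG₁ g k K X) (hU₁ g k K X) hr (hrU₁ g k K X) (ι₁ g k K X) (hf₁ g hg k K X),
    fun g hg k μ ν z => ⟨16 * E₀ * B₃ ^ 2 / r ^ 2, by positivity, fun K X c => ?_⟩⟩
  exact (abs_polComp_expChart_le_of_holomorphicValue _ ρ bV (G₁ g k K X) (hG₁ g k K X) (hU₁ g k K X) hr (hrU₁ g k K X) (hsup₁ g hg k K X) (ι₁ g k K X)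
    (hf₁ g hg k K X)
    (fun t => B₃ * Real.exp (-δ₀ * distCT (domCount (F.P K) M (k + 1)) M
      (fun i => (ZMod.cast (t i) : ZMod (domCount (F.P K) M (k + 1) * M)))
      (nearT (M := M) (fun i => (ZMod.cast (t i) : ZMod (domCount (F.P K) M (k + 1) * M))) X)))
    (htail₁ g k K X) _ _ _ _ c).trans (le_of_eq (sixteen_mul_weights_eq _ _ _ _ _ _))

end ChartData

/-! ## §2 THE PACKAGE AT THE RECORD, chart-data edition: `hC hval hstab` of road (C) + road (A)'s two-run holomorphic data ⇒ the four letters of record (+ `r_inc < 1`) -/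

section Record

open scoped Matrix.Norms.L2Operator

variable {𝔸 : Type*} {Ec : Type*} [NormedAddCommGroup Ec] [NormedSpace ℂ Ec]
variable (F : T4Family) (N : ℕ) [NeZero N] (m' : ℕ) (M : ℕ) [NeZero M] (hM : M = F.L ^ m')

include hM in
open Classical in
/-- ★★★ **NODE U3's FOUR LETTERS OF RECORD FROM ONE TERM-DATA PACKAGE** (chart-data edition; `M = L^{m′}`, ONE `(κ, δ₀)`: `κ, δ₀ > 0`, `κ∕4 ≥ κ₀(64,8)`).  Under W1-20's law
`Localizes17OfRecord₁₃ F N θ S emb`, GIVEN (i) the terms' `C²` charts in the record's β-chart, (ii) K-uniform soft VALUE majorants at `(κ, δ₀)`, (iii) the LOCAL STABILITY RATE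
`|S^{loc}_R(K+1) − S^{loc}_R(K)| ≤ A e^{aR} ω^K` (`K ≥ K_s`, all `R ≥ 0`; `a ≥ 0`, `0 < ω < 1` — quantitative volume independence of the small near terms, DISPLAYED), and (iv) for the
matched (2.13) terms of the run pairs `(K, K+1)` the two-run HOLOMORPHIC data of road (A) — complexifications `ι` with tails `B₃e^{−δ₀distCT}`, `G_B, G_A` holomorphic on an open
`U ⊇ ball 0 r` representing both runs' terms, and the TWO-RUN SUP BOUND `‖G_B − G_A‖ ≤ M₀θ₅^{k+1}e^{−κd(X)}` (term-level NE5, NOT PRINTED for d = 4 — DISPLAYED) — THEN, with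
`r_inc = max{ω^{1∕2}, e^{−ηc}}`, `δ₁ = ½min{δ₀, κ(4M)⁻¹}`, `C₅′ = (16M₀B₃²∕r²)e^{12Mδ₁}K₀(64,8)K₁(4,δ₀∕2)`:
`r_inc < 1 ∧ GeometricIncrementsOfRecord₁₃ F N θ r_inc ∧ PolLimitsExistOfRecord₁₃ F N θ ∧ WindowedStepRateOfRecord₁₃ F N θ 1 δ₁ θ₅ (C₅′θ₅) ∧ KernelStepRateOfRecord₁₃ F N θ δ₁ θ₅ C₅′`
— the rows `hr ∕ hinc ∕ hS` of the finite-volume bill and `hL ∕ h18L` of the limit-letters bill (road (C) · g6 `polLimitsExistOfRecord₁₃_of_geometricIncrements` · road (A) v1.1 ·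
g6 `kernelStepRateOfRecord₁₃_of_geometricIncrements_of_windowed` at `s := 1`); (1.21)-existence is NOT an input.
[cite: Balaban1987RG1, Thm 1 p.259, (1.7) p.261, (1.18) p.263, (1.20)-(1.21) p.264, (4.35)-(4.36) p.290, (4.37) p.291 and (5.10) p.293; Balaban1988RG2Cluster, (2.13)-(2.14) pp.14-15; King1986, (3.73) p.665] -/
theorem u3LettersOfRecord₁₃_of_localTermData (θ : Stage13Params F N) (S : (K : ℕ) → ClusterTower (F.P K) 𝔸 M) (emb : ReadingMaps F (MatA N) 𝔸)
    (hloc : Localizes17OfRecord₁₃ F N θ S emb) {κ δ₀ a ω : ℝ} (hκ0 : 0 < κ) (hδ₀ : 0 < δ₀) (hκ : kappa₀ (4 * 2 ^ 4) (2 * 4) ≤ κ / 2 / 2) (ha : 0 ≤ a)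
    (hω : 0 < ω) (hω1 : ω < 1)
    (hC : letI := θ.instVβ₁; letI := θ.instVβ₂
      ∀ g ∈ Window θ.γ, ∀ (k K : ℕ) (X : (domSys (F.P K) M (k + 1)).Dom),
        ContDiffAt ℝ 2 (expChart (fun W' => (((S K) k).E (histPrefix g k) (emb K k W') X).re) θ.ρ8) 0)
    (hval : letI := θ.instVβ₁; letI := θ.instVβ₂; letI := θ.instιβ
      ∀ g ∈ Window θ.γ, ∀ (k : ℕ) (μ ν : Fin 4) (z : Fin 4 → ℤ), ∃ CE : ℝ, 0 ≤ CE ∧ ∀ (K : ℕ) (X : (domSys (F.P K) M (k + 1)).Dom) (c : θ.ιβ),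
        let e : Site (F.P K) (k + 1) → TPt 4 (domCount (F.P K) M (k + 1) * M) := fun x i => (ZMod.cast (x i) : ZMod (domCount (F.P K) M (k + 1) * M))
        |polComp ℝ (expChart (fun W' => (((S K) k).E (histPrefix g k) (emb K k W') X).re) θ.ρ8) θ.bV (Fin.cast (F.P_d K).symm μ) (siteOfInt F K (k + 1) z) c
            (Fin.cast (F.P_d K).symm ν) (siteOfInt F K (k + 1) 0) c| ≤
          CE * Real.exp (-κ * torusTreeLen X.1) * Real.exp (-δ₀ * distCT (domCount (F.P K) M (k + 1)) M (e (siteOfInt F K (k + 1) z)) (nearT (M := M) (e (siteOfInt F K (k + 1) z)) X)) *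
            Real.exp (-δ₀ * distCT (domCount (F.P K) M (k + 1)) M (e (siteOfInt F K (k + 1) 0)) (nearT (M := M) (e (siteOfInt F K (k + 1) 0)) X)))
    (hstab : letI := θ.instVβ₁; letI := θ.instVβ₂; letI := θ.instιβ
      ∀ g ∈ Window θ.γ, ∀ (k : ℕ) (μ ν : Fin 4) (z : Fin 4 → ℤ), ∃ (Ks : ℕ) (A : ℝ), 0 ≤ A ∧ ∀ R : ℝ, 0 ≤ R → ∀ K, Ks ≤ K →
        |(∑ X ∈ Finset.univ.filter (fun X : (domSys (F.P (K + 1)) M (k + 1)).Dom =>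
            ¬ (R < torusTreeLen X.1 ∨ R < distCT (domCount (F.P (K + 1)) M (k + 1)) M
              (fun i : Fin 4 => (ZMod.cast (siteOfInt F (K + 1) (k + 1) 0 i) : ZMod (domCount (F.P (K + 1)) M (k + 1) * M)))
              (nearT (M := M) (fun i : Fin 4 => (ZMod.cast (siteOfInt F (K + 1) (k + 1) 0 i) : ZMod (domCount (F.P (K + 1)) M (k + 1) * M))) X))),
            polScalar (fun W' => (((S (K + 1)) k).E (histPrefix g k) (emb (K + 1) k W') X).re) θ.ρ8 θ.bV (Fin.cast (F.P_d (K + 1)).symm μ) (siteOfInt F (K + 1) (k + 1) z)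
              (Fin.cast (F.P_d (K + 1)).symm ν) (siteOfInt F (K + 1) (k + 1) 0)) -
          (∑ X ∈ Finset.univ.filter (fun X : (domSys (F.P K) M (k + 1)).Dom =>
            ¬ (R < torusTreeLen X.1 ∨ R < distCT (domCount (F.P K) M (k + 1)) M
              (fun i : Fin 4 => (ZMod.cast (siteOfInt F K (k + 1) 0 i) : ZMod (domCount (F.P K) M (k + 1) * M)))
              (nearT (M := M) (fun i : Fin 4 => (ZMod.cast (siteOfInt F K (k + 1) 0 i) : ZMod (domCount (F.P K) M (k + 1) * M))) X))),
            polScalar (fun W' => (((S K) k).E (histPrefix g k) (emb K k W') X).re) θ.ρ8 θ.bV (Fin.cast (F.P_d K).symm μ) (siteOfInt F K (k + 1) z)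
              (Fin.cast (F.P_d K).symm ν) (siteOfInt F K (k + 1) 0))| ≤ A * Real.exp (a * R) * ω ^ K)
    {θ₅ r M₀ B₃ : ℝ} (hθ₅ : 0 ≤ θ₅) (hr : 0 < r) (hM₀ : 0 ≤ M₀) (hB₃ : 0 ≤ B₃)
    (ιc : letI := θ.instVβ₁; letI := θ.instVβ₂
      (k : ℕ) → (Fin (k + 2) → ℝ) → (K : ℕ) → (domSys (F.P (K + 1)) M (k + 1 + 1)).Dom → ((Fin (F.P (K + 1)).d → Site (F.P (K + 1)) (k + 1 + 1) → θ.Vβ) →L[ℝ] Ec))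
    (GB GA : (k : ℕ) → (Fin (k + 2) → ℝ) → (K : ℕ) → (domSys (F.P (K + 1)) M (k + 1 + 1)).Dom → Ec → ℂ)
    (U : (k : ℕ) → (Fin (k + 2) → ℝ) → (K : ℕ) → (domSys (F.P (K + 1)) M (k + 1 + 1)).Dom → Set Ec) (hU : ∀ k w K X, IsOpen (U k w K X))
    (hGB : ∀ k w K X, DifferentiableOn ℂ (GB k w K X) (U k w K X)) (hGA : ∀ k w K X, DifferentiableOn ℂ (GA k w K X) (U k w K X))
    (hrU : ∀ k w K X, ball (0 : Ec) r ⊆ U k w K X)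
    (hfB : letI := θ.instVβ₁; letI := θ.instVβ₂
      ∀ (k : ℕ) (w : Fin (k + 2) → ℝ), w ∈ Box θ.γ (k + 1) → ∀ (K : ℕ) (X : (domSys (F.P (K + 1)) M (k + 1 + 1)).Dom) (B),
        expChart (fun W' => (((S (K + 1)) (k + 1)).E w (emb (K + 1) (k + 1) W') X).re) θ.ρ8 B = (GB k w K X (ιc k w K X B)).re)
    (hfA : letI := θ.instVβ₁; letI := θ.instVβ₂
      ∀ (k : ℕ) (w : Fin (k + 2) → ℝ), w ∈ Box θ.γ (k + 1) → ∀ (K : ℕ) (X : (domSys (F.P (K + 1)) M (k + 1 + 1)).Dom) (B),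
        expChart (fun W' : Fin (F.P (K + 1)).d → Site (F.P (K + 1)) (k + 1 + 1) → MatA N =>
          (((S K) k).E (Fin.tail w) (emb K k (fun κ' y => W' κ' (siteShift (ladder F K k) y))) (castDom (domSys_succ F M K (k + 1)) X)).re) θ.ρ8 B =
          (GA k w K X (ιc k w K X B)).re)
    (hsup : ∀ (k : ℕ) (w : Fin (k + 2) → ℝ), w ∈ Box θ.γ (k + 1) → ∀ (K : ℕ) (X : (domSys (F.P (K + 1)) M (k + 1 + 1)).Dom), ∀ ζ ∈ ball (0 : Ec) r,
      ‖GB k w K X ζ - GA k w K X ζ‖ ≤ M₀ * θ₅ ^ (k + 1) * Real.exp (-κ * torusTreeLen X.1))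
    (htail : letI := θ.instVβ₁; letI := θ.instVβ₂; letI := θ.instιβ
      ∀ (k : ℕ) (w : Fin (k + 2) → ℝ) (K : ℕ) (X : (domSys (F.P (K + 1)) M (k + 1 + 1)).Dom) (l : Fin (F.P (K + 1)).d) (t : Site (F.P (K + 1)) (k + 1 + 1)) (c : θ.ιβ),
        let e : Site (F.P (K + 1)) (k + 1 + 1) → TPt 4 (domCount (F.P (K + 1)) M (k + 1 + 1) * M) :=
          fun x i => (ZMod.cast (x i) : ZMod (domCount (F.P (K + 1)) M (k + 1 + 1) * M))
        ‖ιc k w K X (Pi.single l (Pi.single t (θ.bV c)))‖ ≤ B₃ * Real.exp (-δ₀ * distCT (domCount (F.P (K + 1)) M (k + 1 + 1)) M (e t) (nearT (M := M) (e t) X))) :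
    max (Real.exp (Real.log ω / 2)) (Real.exp (-(min κ δ₀ / 2) * (-Real.log ω / (2 * (a + 1))))) < 1 ∧
    GeometricIncrementsOfRecord₁₃ F N θ (max (Real.exp (Real.log ω / 2)) (Real.exp (-(min κ δ₀ / 2) * (-Real.log ω / (2 * (a + 1)))))) ∧
    PolLimitsExistOfRecord₁₃ F N θ ∧
    WindowedStepRateOfRecord₁₃ F N θ 1 (delta1 δ₀ κ ((M : ℝ) * 4)) θ₅
      (16 * M₀ * B₃ ^ 2 / r ^ 2 * Real.exp (delta1 δ₀ κ ((M : ℝ) * 4) * ((M : ℝ) * 4) * 3) * K₀ (4 * 2 ^ 4) (2 * 4) * K₁ 4 (δ₀ / 2) * θ₅) ∧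
    KernelStepRateOfRecord₁₃ F N θ (delta1 δ₀ κ ((M : ℝ) * 4)) θ₅
      (16 * M₀ * B₃ ^ 2 / r ^ 2 * Real.exp (delta1 δ₀ κ ((M : ℝ) * 4) * ((M : ℝ) * 4) * 3) * K₀ (4 * 2 ^ 4) (2 * 4) * K₁ 4 (δ₀ / 2)) := by
  have hinc := geometricIncrementsOfRecord₁₃_of_localStabilityRate F N m' M hM θ S emb hloc hκ0 hδ₀ hκ ha hω hω1 hC hval hstab
  have hη : 0 < min κ δ₀ / 2 := by have := lt_min hκ0 hδ₀; linarith
  have hrr := twoScaleRate_lt_one hη ha hω hω1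
  have hκ2 : kappa₀ (4 * 2 ^ 4) (2 * 4) ≤ κ / 2 := hκ.trans (by linarith)
  have hS := windowedStepRateOfRecord₁₃_one_of_holomorphicTwoRun F N m' M hM θ S emb hloc hθ₅ hr hM₀ hB₃ hδ₀ hκ2 ιc GB GA U hU hGB hGA hrU hfB hfA hsup htail
  exact ⟨hrr, hinc, polLimitsExistOfRecord₁₃_of_geometricIncrements F N θ hrr hinc, hS,
    kernelStepRateOfRecord₁₃_of_geometricIncrements_of_windowed F N θ 1 hrr hinc hS⟩

include hM in
open Classical in
/-- ★★★ **NODE U3's FOUR LETTERS OF RECORD FROM ONE TERM-DATA PACKAGE — ANALYTIC EDITION.**  As `u3LettersOfRecord₁₃_of_localTermData`, with the two chart rows `hC ∕ hval`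
REPLACED by the print-shaped single-run analytic input of §1b: for every `(g ∈ Window θ.γ, k, K, X)` the (2.13) term's record β-chart is `Re G ∘ ι` — `ι` a real-linear
complexification of the probe fields with the (4.35) tails `B₃e^{−δ₀ distCT(cast t, X)}`, `G` holomorphic on an open `U ⊇ ball 0 r`, `‖G‖ ≤ E₀e^{−κd(X)}` on the ball ([I] p. 264,
(1.18), (4.35)–(4.37)).  ONE `(κ, δ₀, r, B₃)` for the single-run and the two-run data.  Conclusion: `r_inc < 1 ∧ GeometricIncrementsOfRecord₁₃ … r_inc ∧ PolLimitsExistOfRecord₁₃ … ∧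
WindowedStepRateOfRecord₁₃ … 1 δ₁ θ₅ (C₅′θ₅) ∧ KernelStepRateOfRecord₁₃ … δ₁ θ₅ C₅′`.  What stays DISPLAYED: W1-20's law, the analytic representations (NODE A ∕ N10), the local
stability rate, the term-level two-run sup bound (node N18's content, NOT PRINTED for d = 4).
[cite: Balaban1987RG1, Thm 1 p.259, (1.7) p.261, (1.18) p.263, (1.20)-(1.21) p.264, (4.35)-(4.36) p.290, (4.37) p.291 and (5.10) p.293; Balaban1988RG2Cluster, (2.13)-(2.14) pp.14-15; King1986, (3.73) p.665] -/
theorem u3LettersOfRecord₁₃_of_analyticLocalTermData (θ : Stage13Params F N) (S : (K : ℕ) → ClusterTower (F.P K) 𝔸 M) (emb : ReadingMaps F (MatA N) 𝔸)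
    (hloc : Localizes17OfRecord₁₃ F N θ S emb) {κ δ₀ a ω r E₀ B₃ : ℝ} (hκ0 : 0 < κ) (hδ₀ : 0 < δ₀) (hκ : kappa₀ (4 * 2 ^ 4) (2 * 4) ≤ κ / 2 / 2) (ha : 0 ≤ a)
    (hω : 0 < ω) (hω1 : ω < 1) (hr : 0 < r) (hE₀ : 0 ≤ E₀) (hB₃ : 0 ≤ B₃)
    (ι₁ : letI := θ.instVβ₁; letI := θ.instVβ₂
      (g : ℕ → ℝ) → (k K : ℕ) → (domSys (F.P K) M (k + 1)).Dom → ((Fin (F.P K).d → Site (F.P K) (k + 1) → θ.Vβ) →L[ℝ] Ec))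
    (G₁ : (g : ℕ → ℝ) → (k K : ℕ) → (domSys (F.P K) M (k + 1)).Dom → Ec → ℂ)
    (U₁ : (g : ℕ → ℝ) → (k K : ℕ) → (domSys (F.P K) M (k + 1)).Dom → Set Ec) (hU₁ : ∀ g k K X, IsOpen (U₁ g k K X))
    (hG₁ : ∀ g k K X, DifferentiableOn ℂ (G₁ g k K X) (U₁ g k K X)) (hrU₁ : ∀ g k K X, ball (0 : Ec) r ⊆ U₁ g k K X)
    (hf₁ : letI := θ.instVβ₁; letI := θ.instVβ₂
      ∀ g ∈ Window θ.γ, ∀ (k K : ℕ) (X : (domSys (F.P K) M (k + 1)).Dom) (B : Fin (F.P K).d → Site (F.P K) (k + 1) → θ.Vβ),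
        expChart (fun W' => (((S K) k).E (histPrefix g k) (emb K k W') X).re) θ.ρ8 B = (G₁ g k K X (ι₁ g k K X B)).re)
    (hsup₁ : ∀ g ∈ Window θ.γ, ∀ (k K : ℕ) (X : (domSys (F.P K) M (k + 1)).Dom), ∀ ζ ∈ ball (0 : Ec) r, ‖G₁ g k K X ζ‖ ≤ E₀ * Real.exp (-κ * torusTreeLen X.1))
    (htail₁ : letI := θ.instVβ₁; letI := θ.instVβ₂; letI := θ.instιβ
      ∀ (g : ℕ → ℝ) (k K : ℕ) (X : (domSys (F.P K) M (k + 1)).Dom) (l : Fin (F.P K).d) (t : Site (F.P K) (k + 1)) (c : θ.ιβ),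
        let e : Site (F.P K) (k + 1) → TPt 4 (domCount (F.P K) M (k + 1) * M) := fun x i => (ZMod.cast (x i) : ZMod (domCount (F.P K) M (k + 1) * M))
        ‖ι₁ g k K X (Pi.single l (Pi.single t (θ.bV c)))‖ ≤ B₃ * Real.exp (-δ₀ * distCT (domCount (F.P K) M (k + 1)) M (e t) (nearT (M := M) (e t) X)))
    (hstab : letI := θ.instVβ₁; letI := θ.instVβ₂; letI := θ.instιβ
      ∀ g ∈ Window θ.γ, ∀ (k : ℕ) (μ ν : Fin 4) (z : Fin 4 → ℤ), ∃ (Ks : ℕ) (A : ℝ), 0 ≤ A ∧ ∀ R : ℝ, 0 ≤ R → ∀ K, Ks ≤ K →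
        |(∑ X ∈ Finset.univ.filter (fun X : (domSys (F.P (K + 1)) M (k + 1)).Dom =>
            ¬ (R < torusTreeLen X.1 ∨ R < distCT (domCount (F.P (K + 1)) M (k + 1)) M
              (fun i : Fin 4 => (ZMod.cast (siteOfInt F (K + 1) (k + 1) 0 i) : ZMod (domCount (F.P (K + 1)) M (k + 1) * M)))
              (nearT (M := M) (fun i : Fin 4 => (ZMod.cast (siteOfInt F (K + 1) (k + 1) 0 i) : ZMod (domCount (F.P (K + 1)) M (k + 1) * M))) X))),
            polScalar (fun W' => (((S (K + 1)) k).E (histPrefix g k) (emb (K + 1) k W') X).re) θ.ρ8 θ.bV (Fin.cast (F.P_d (K + 1)).symm μ) (siteOfInt F (K + 1) (k + 1) z)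
              (Fin.cast (F.P_d (K + 1)).symm ν) (siteOfInt F (K + 1) (k + 1) 0)) -
          (∑ X ∈ Finset.univ.filter (fun X : (domSys (F.P K) M (k + 1)).Dom =>
            ¬ (R < torusTreeLen X.1 ∨ R < distCT (domCount (F.P K) M (k + 1)) M
              (fun i : Fin 4 => (ZMod.cast (siteOfInt F K (k + 1) 0 i) : ZMod (domCount (F.P K) M (k + 1) * M)))
              (nearT (M := M) (fun i : Fin 4 => (ZMod.cast (siteOfInt F K (k + 1) 0 i) : ZMod (domCount (F.P K) M (k + 1) * M))) X))),
            polScalar (fun W' => (((S K) k).E (histPrefix g k) (emb K k W') X).re) θ.ρ8 θ.bV (Fin.cast (F.P_d K).symm μ) (siteOfInt F K (k + 1) z)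
              (Fin.cast (F.P_d K).symm ν) (siteOfInt F K (k + 1) 0))| ≤ A * Real.exp (a * R) * ω ^ K)
    {θ₅ M₀ : ℝ} (hθ₅ : 0 ≤ θ₅) (hM₀ : 0 ≤ M₀)
    (ιc : letI := θ.instVβ₁; letI := θ.instVβ₂
      (k : ℕ) → (Fin (k + 2) → ℝ) → (K : ℕ) → (domSys (F.P (K + 1)) M (k + 1 + 1)).Dom → ((Fin (F.P (K + 1)).d → Site (F.P (K + 1)) (k + 1 + 1) → θ.Vβ) →L[ℝ] Ec))
    (GB GA : (k : ℕ) → (Fin (k + 2) → ℝ) → (K : ℕ) → (domSys (F.P (K + 1)) M (k + 1 + 1)).Dom → Ec → ℂ)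
    (U : (k : ℕ) → (Fin (k + 2) → ℝ) → (K : ℕ) → (domSys (F.P (K + 1)) M (k + 1 + 1)).Dom → Set Ec) (hU : ∀ k w K X, IsOpen (U k w K X))
    (hGB : ∀ k w K X, DifferentiableOn ℂ (GB k w K X) (U k w K X)) (hGA : ∀ k w K X, DifferentiableOn ℂ (GA k w K X) (U k w K X))
    (hrU : ∀ k w K X, ball (0 : Ec) r ⊆ U k w K X)
    (hfB : letI := θ.instVβ₁; letI := θ.instVβ₂
      ∀ (k : ℕ) (w : Fin (k + 2) → ℝ), w ∈ Box θ.γ (k + 1) → ∀ (K : ℕ) (X : (domSys (F.P (K + 1)) M (k + 1 + 1)).Dom) (B),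
        expChart (fun W' => (((S (K + 1)) (k + 1)).E w (emb (K + 1) (k + 1) W') X).re) θ.ρ8 B = (GB k w K X (ιc k w K X B)).re)
    (hfA : letI := θ.instVβ₁; letI := θ.instVβ₂
      ∀ (k : ℕ) (w : Fin (k + 2) → ℝ), w ∈ Box θ.γ (k + 1) → ∀ (K : ℕ) (X : (domSys (F.P (K + 1)) M (k + 1 + 1)).Dom) (B),
        expChart (fun W' : Fin (F.P (K + 1)).d → Site (F.P (K + 1)) (k + 1 + 1) → MatA N =>
          (((S K) k).E (Fin.tail w) (emb K k (fun κ' y => W' κ' (siteShift (ladder F K k) y))) (castDom (domSys_succ F M K (k + 1)) X)).re) θ.ρ8 B =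
          (GA k w K X (ιc k w K X B)).re)
    (hsup : ∀ (k : ℕ) (w : Fin (k + 2) → ℝ), w ∈ Box θ.γ (k + 1) → ∀ (K : ℕ) (X : (domSys (F.P (K + 1)) M (k + 1 + 1)).Dom), ∀ ζ ∈ ball (0 : Ec) r,
      ‖GB k w K X ζ - GA k w K X ζ‖ ≤ M₀ * θ₅ ^ (k + 1) * Real.exp (-κ * torusTreeLen X.1))
    (htail : letI := θ.instVβ₁; letI := θ.instVβ₂; letI := θ.instιβ
      ∀ (k : ℕ) (w : Fin (k + 2) → ℝ) (K : ℕ) (X : (domSys (F.P (K + 1)) M (k + 1 + 1)).Dom) (l : Fin (F.P (K + 1)).d) (t : Site (F.P (K + 1)) (k + 1 + 1)) (c : θ.ιβ),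
        let e : Site (F.P (K + 1)) (k + 1 + 1) → TPt 4 (domCount (F.P (K + 1)) M (k + 1 + 1) * M) :=
          fun x i => (ZMod.cast (x i) : ZMod (domCount (F.P (K + 1)) M (k + 1 + 1) * M))
        ‖ιc k w K X (Pi.single l (Pi.single t (θ.bV c)))‖ ≤ B₃ * Real.exp (-δ₀ * distCT (domCount (F.P (K + 1)) M (k + 1 + 1)) M (e t) (nearT (M := M) (e t) X))) :
    max (Real.exp (Real.log ω / 2)) (Real.exp (-(min κ δ₀ / 2) * (-Real.log ω / (2 * (a + 1))))) < 1 ∧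
    GeometricIncrementsOfRecord₁₃ F N θ (max (Real.exp (Real.log ω / 2)) (Real.exp (-(min κ δ₀ / 2) * (-Real.log ω / (2 * (a + 1)))))) ∧
    PolLimitsExistOfRecord₁₃ F N θ ∧
    WindowedStepRateOfRecord₁₃ F N θ 1 (delta1 δ₀ κ ((M : ℝ) * 4)) θ₅
      (16 * M₀ * B₃ ^ 2 / r ^ 2 * Real.exp (delta1 δ₀ κ ((M : ℝ) * 4) * ((M : ℝ) * 4) * 3) * K₀ (4 * 2 ^ 4) (2 * 4) * K₁ 4 (δ₀ / 2) * θ₅) ∧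
    KernelStepRateOfRecord₁₃ F N θ (delta1 δ₀ κ ((M : ℝ) * 4)) θ₅
      (16 * M₀ * B₃ ^ 2 / r ^ 2 * Real.exp (delta1 δ₀ κ ((M : ℝ) * 4) * ((M : ℝ) * 4) * 3) * K₀ (4 * 2 ^ 4) (2 * 4) * K₁ 4 (δ₀ / 2)) := by
  letI := θ.instVβ₁; letI := θ.instVβ₂; letI := θ.instιβ
  obtain ⟨hC, hval⟩ := chartData_localizedSum_of_holomorphicValue F M S emb θ.ρ8 θ.bV (Window θ.γ) hr hE₀ ι₁ G₁ U₁ hU₁ hG₁ hrU₁ hf₁ hsup₁ htail₁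
  exact u3LettersOfRecord₁₃_of_localTermData F N m' M hM θ S emb hloc hκ0 hδ₀ hκ ha hω hω1 hC hval hstab hθ₅ hr hM₀ hB₃ ιc GB GA U hU hGB hGA hrU
    hfB hfA hsup htail

end Record

end YMDAG.N18.U3LettersPackage

end
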